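import Mathlib.MeasureTheory.Integral.Prod
import Mathlib.MeasureTheory.Integral.IntervalIntegral.Basic
import Mathlib.Topology.EMetricSpace.BoundedVariation
import Literature.Probability.RandomPlanarGeometry.TangentAtSLE6Sectors
import HarnessLib

/-!
# Sector inclusions for route item SectorExhaustion (stmt-CriticalPhenomena-14302)

Helper lemmas about the named sectors of `TangentAtSLE6Sectors.lean` (definition item
`defn-TangentAtSLE6`), supporting the informal route item SectorExhaustion of route
CardyAnchoredRigidity (`CriticalPhenomena/CardyFormulaZ2`):

* `cameronMartinPerturbations_subset_finiteVariationPerturbations` — a Cameron–Martin perturbation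
  `A_t = ∫₀ᵗ β_s ds` (`β` bounded, progressive for the Brownian filtration) is a finite-variation
  perturbation: progressive (parametric Bochner integrals of jointly measurable integrands are
  measurable), `A_0 = 0`, Lipschitz in `t` (hence continuous and of locally bounded variation);
* hence `driftSector ≤ singularDriverSector` and
  `namedSectors P₀ 𝒯 = twistSector P₀ 𝒯 ⊔ singularDriverSector P₀ 𝒯`: as defined in the tree only
  two of the three named sectors are independent, so "every tangent vector is a sum of the three
  sectors" is the statement `tangentCone 𝒞 P₀ 𝒯 ⊆ twistSector ⊔ singularDriverSector`.

Sources: D. Revuz, M. Yor, *Continuous Martingales and Brownian Motion* (1999), Ch. I §4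
(progressive measurability), Ch. VIII §1 (Cameron–Martin drifts). Mathlib:
`MeasureTheory.StronglyMeasurable.integral_prod_right`, `intervalIntegral.integral_interval_sub_left`,
`intervalIntegral.norm_integral_le_of_norm_le_const`, `LipschitzOnWith.comp_locallyBoundedVariationOn`.
-/

noncomputable section

open Set MeasureTheory Topology Filter

namespace Literature.Probability.RandomPlanarGeometry

namespace ChordalFamily

/-! ### Measurability of sections and of parametric interval integrals -/

section Measurability

variable {X : Type*} [MeasurableSpace X]

/-- A time section `s ↦ b (min s i) x` (real time, clipped at `i`) of an integrand that is jointly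
measurable on `[0, i] × X` is Borel measurable. [folklore] -/
theorem measurable_section_min (i : NNReal) {b : NNReal → X → ℝ}
    (hb : Measurable fun p : Iic i × X => b p.1 p.2) (x : X) :
    Measurable fun s : ℝ => b (min (Real.toNNReal s) i) x := by
  have h : (fun s : ℝ => b (min (Real.toNNReal s) i) x) =
      (fun p : Iic i × X => b p.1 p.2) ∘ fun s : ℝ =>
        ((⟨min (Real.toNNReal s) i, Set.mem_Iic.2 (min_le_right _ _)⟩ : Iic i), x) := rfl
  rw [h]
  exact hb.comp ((measurable_id.real_toNNReal.min measurable_const).subtype_mk.prodMk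
    measurable_const)

/-- **Parametric interval integrals are jointly measurable.** If `b` is jointly measurable on
`[0, i] × X`, then `(t, x) ↦ ∫₀ᵗ b (s, x) ds` is jointly measurable on `[0, i] × X` (the
integrand `(t, x; s) ↦ 𝟙[s ≤ t] b (s ∧ i, x)` is jointly measurable and Bochner integration in `s`
preserves measurability, `StronglyMeasurable.integral_prod_right`). Revuz–Yor Ch. I §4 (the
integral of a progressive process is progressive). [folklore] -/
theorem measurable_intervalIntegral_of_measurable (i : NNReal) {b : NNReal → X → ℝ}
    (hb : Measurable fun p : Iic i × X => b p.1 p.2) :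
    Measurable fun p : Iic i × X =>
      ∫ s in (0 : ℝ)..((p.1 : NNReal) : ℝ), b (Real.toNNReal s) p.2 := by
  -- the jointly measurable integrand
  set G : (Iic i × X) → ℝ → ℝ := fun p s =>
    if s ≤ ((p.1 : NNReal) : ℝ) then b (min (Real.toNNReal s) i) p.2 else 0 with hG
  have hGm : Measurable (Function.uncurry G) := by
    refine Measurable.ite ?_ ?_ measurable_const
    · exact measurableSet_le measurable_snd
        (measurable_fst.fst.subtype_val.coe_nnreal_real)
    · have h : (fun q : (Iic i × X) × ℝ => b (min (Real.toNNReal q.2) i) q.1.2) =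
          (fun p : Iic i × X => b p.1 p.2) ∘ fun q : (Iic i × X) × ℝ =>
            ((⟨min (Real.toNNReal q.2) i, Set.mem_Iic.2 (min_le_right _ _)⟩ : Iic i), q.1.2) := rfl
      rw [h]
      exact hb.comp ((measurable_snd.real_toNNReal.min measurable_const).subtype_mk.prodMk
        measurable_fst.snd)
  have hkey : StronglyMeasurable fun p : Iic i × X =>
      ∫ s, G p s ∂(volume.restrict (Ioc (0 : ℝ) i)) :=
    hGm.stronglyMeasurable.integral_prod_right
  -- identify the parametric integral with the interval integral
  have hfun : (fun p : Iic i × X =>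
      ∫ s in (0 : ℝ)..((p.1 : NNReal) : ℝ), b (Real.toNNReal s) p.2) =
      fun p : Iic i × X => ∫ s, G p s ∂(volume.restrict (Ioc (0 : ℝ) i)) := by
    funext p
    have ht0 : (0 : ℝ) ≤ ((p.1 : NNReal) : ℝ) := NNReal.coe_nonneg _
    have hti : ((p.1 : NNReal) : ℝ) ≤ (i : ℝ) := NNReal.coe_le_coe.2 p.1.2
    have hGp : G p = (Iic ((p.1 : NNReal) : ℝ)).indicator
        fun s => b (min (Real.toNNReal s) i) p.2 := by
      funext s
      simp only [hG, Set.indicator_apply, Set.mem_Iic]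
    rw [intervalIntegral.integral_of_le ht0, hGp, integral_indicator measurableSet_Iic,
      Measure.restrict_restrict measurableSet_Iic]
    have hset : Iic ((p.1 : NNReal) : ℝ) ∩ Ioc (0 : ℝ) i = Ioc (0 : ℝ) ((p.1 : NNReal) : ℝ) := by
      ext s
      simp only [Set.mem_inter_iff, Set.mem_Iic, Set.mem_Ioc]
      constructor
      · rintro ⟨h1, h2, -⟩
        exact ⟨h2, h1⟩
      · rintro ⟨h1, h2⟩
        exact ⟨h2, h1, h2.trans hti⟩
    rw [hset]
    refine setIntegral_congr_fun measurableSet_Ioc fun s hs => ?_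
    have hsi : Real.toNNReal s ≤ i := by
      have h1 : Real.toNNReal s ≤ Real.toNNReal ((p.1 : NNReal) : ℝ) :=
        Real.toNNReal_le_toNNReal hs.2
      rw [Real.toNNReal_coe] at h1
      exact h1.trans p.1.2
    simp only [min_eq_left hsi]
  rw [hfun]
  exact hkey.measurable

end Measurability

/-! ### Cameron–Martin perturbations are finite-variation perturbations -/

/-- **Cameron–Martin perturbations of the driver are finite-variation perturbations**:
`A_t = ∫₀ᵗ β_s ds` with `β` bounded and progressive is progressive, starts at `0`, and is
Lipschitz in `t` — so continuous and of locally bounded variation. Revuz–Yor Ch. VIII §1.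
[folklore] -/
theorem cameronMartinPerturbations_subset_finiteVariationPerturbations :
    cameronMartinPerturbations ⊆ finiteVariationPerturbations := by
  rintro A ⟨β, hβ, ⟨C, hC⟩, hA⟩
  -- time sections of the integrand are measurable and bounded, hence interval integrable
  have hint : ∀ (ω : NNReal → ℝ) (a c : ℝ),
      IntervalIntegrable (fun s : ℝ => β (Real.toNNReal s) ω) volume a c := by
    intro ω a c
    set i : NNReal := Real.toNNReal (max a c) with hi
    have hm : Measurable fun s : ℝ => β (min (Real.toNNReal s) i) ω :=
      @measurable_section_min (NNReal → ℝ) (brownianFiltration i) i β (hβ i) ω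
    rw [intervalIntegrable_iff]
    have hfin : volume (Set.uIoc a c) ≠ ⊤ := by
      refine ne_top_of_le_ne_top ?_ (measure_mono (Set.Ioc_subset_Icc_self))
      rw [Real.volume_Icc]
      exact ENNReal.ofReal_ne_top
    have h1 : IntegrableOn (fun s : ℝ => β (min (Real.toNNReal s) i) ω) (Set.uIoc a c) volume :=
      Measure.integrableOn_of_bounded hfin hm.aestronglyMeasurable
        (ae_of_all _ fun s => by
          rw [Real.norm_eq_abs]
          exact hC _ _)
    refine h1.congr_fun (fun s hs => ?_) measurableSet_uIoc
    have hsi : Real.toNNReal s ≤ i := by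
      rw [hi]
      exact Real.toNNReal_le_toNNReal hs.2
    simp only [min_eq_left hsi]
  -- the real-time primitive is Lipschitz
  have hLip : ∀ ω : NNReal → ℝ, LipschitzWith (Real.toNNReal C)
      fun t : ℝ => ∫ s in (0 : ℝ)..t, β (Real.toNNReal s) ω := by
    intro ω
    refine LipschitzWith.of_dist_le_mul fun x y => ?_
    rw [Real.dist_eq, Real.dist_eq,
      intervalIntegral.integral_interval_sub_left (hint ω 0 x) (hint ω 0 y)]
    have h1 : ‖∫ s in y..x, β (Real.toNNReal s) ω‖ ≤ C * |x - y| :=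
      intervalIntegral.norm_integral_le_of_norm_le_const fun s _ => by
        rw [Real.norm_eq_abs]
        exact hC _ _
    rw [Real.norm_eq_abs] at h1
    exact h1.trans (mul_le_mul_of_nonneg_right (Real.le_coe_toNNReal C) (abs_nonneg _))
  have hAfun : ∀ ω : NNReal → ℝ, (fun t : NNReal => A t ω) =
      (fun t : ℝ => ∫ s in (0 : ℝ)..t, β (Real.toNNReal s) ω) ∘ fun t : NNReal => (t : ℝ) := by
    intro ω
    funext t
    exact hA t ω
  refine ⟨fun i => ?_, fun ω => ⟨?_, ?_, ?_⟩⟩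
  · -- progressive
    have h := @measurable_intervalIntegral_of_measurable (NNReal → ℝ) (brownianFiltration i) i β
      (hβ i)
    have hfun : (fun p : Iic i × (NNReal → ℝ) => A p.1 p.2) =
        fun p : Iic i × (NNReal → ℝ) =>
          ∫ s in (0 : ℝ)..((p.1 : NNReal) : ℝ), β (Real.toNNReal s) p.2 :=
      funext fun p => hA _ _
    rw [hfun]
    exact h
  · -- starts at 0
    rw [hA, NNReal.coe_zero, intervalIntegral.integral_same]
  · -- continuous
    rw [hAfun ω]
    exact (hLip ω).continuous.comp NNReal.continuous_coe
  · -- locally bounded variation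
    rw [hAfun ω]
    exact ((hLip ω).lipschitzOnWith (s := Set.univ)).comp_locallyBoundedVariationOn
      (Set.mapsTo_univ _ _) ((NNReal.coe_mono.monotoneOn Set.univ).locallyBoundedVariationOn)

/-- Hence Cameron–Martin driver velocities are finite-variation driver velocities … [folklore] -/
theorem driverVelocities_cameronMartin_subset (P₀ : ChordalFamily) (𝒯 : Set (CurveClass ℂ → ℝ)) :
    driverVelocities P₀ 𝒯 cameronMartinPerturbations ⊆
      driverVelocities P₀ 𝒯 finiteVariationPerturbations :=
  driverVelocities_mono P₀ 𝒯 cameronMartinPerturbations_subset_finiteVariationPerturbations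

/-- … the drift–diffusivity sector is contained in the finite-variation driver sector … [folklore] -/
theorem driftSector_le_singularDriverSector (P₀ : ChordalFamily) (𝒯 : Set (CurveClass ℂ → ℝ)) :
    driftSector P₀ 𝒯 ≤ singularDriverSector P₀ 𝒯 :=
  Submodule.span_mono (driverVelocities_cameronMartin_subset P₀ 𝒯)

/-- … and the three named sectors reduce to two:
`namedSectors P₀ 𝒯 = twistSector P₀ 𝒯 ⊔ singularDriverSector P₀ 𝒯`. [folklore] -/
theorem namedSectors_eq_twistSector_sup_singularDriverSector (P₀ : ChordalFamily)
    (𝒯 : Set (CurveClass ℂ → ℝ)) :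
    namedSectors P₀ 𝒯 = twistSector P₀ 𝒯 ⊔ singularDriverSector P₀ 𝒯 := by
  unfold namedSectors
  refine le_antisymm (sup_le (sup_le le_sup_left ?_) le_sup_right) (sup_le ?_ le_sup_right)
  · exact (driftSector_le_singularDriverSector P₀ 𝒯).trans le_sup_right
  · exact le_sup_left.trans le_sup_left

end ChordalFamily

end Literature.Probability.RandomPlanarGeometry
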